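import Mathlib
import Literature.Analysis.FluidPDE.PressurePoisson
import Literature.Analysis.FluidPDE.SpaceTimeMixedPartials
import Literature.Analysis.FluidPDE.EnstrophySplitting
import Literature.Analysis.FluidPDE.SteadyNSCaccioppoli
import HarnessLib

/-!
# Anchor of crux `LinearLiouvilleSeven` (route `SymmetryModuliCount`), pressure step

Registered stub `stub_anchorPressure` (A3a) of the lead's skeleton for crux
stmt-NavierStokesRegularity-4054, line `galilean-collapse`
(`Cruxes/LinearLiouvilleSeven/Lines/galilean-collapse.lean`). The anchor is the `u = 0` case of
the crux: tempered classical ancient solutions `(v, q)` of the Stokes system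
`∂ₜv = Δv − ∇q`, `div v = 0` on `(−∞, 0) × ℝ³` are spatially constant on every slice. This file
proves its PRESSURE STEP from the harmonic-gradient input (stub A1,
`stub_harmonicLinearGrowthGradient`):

* (P1) `Δ q(t, ·) = 0` — take the divergence of the momentum equation: `div ∂ₜv = ∂ₜ div v = 0`
  (exchange of `∂ₜ` and `D` for the jointly smooth `v`), `div Δv = 0` (`div v = 0`, Schwarz),
  `div ∇q = Δq`;
* (P2) a harmonic function of linear growth has gradient bounded by `C₀ ·` slope everywhere
  (A1), so `‖∇q(t, x)‖ ≤ C₀ K/√(−t)³`; each `∂ₑq(t, ·)` is then bounded AND harmonic, so A1 with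
  slope `0` kills its gradient: the Hessian of `q(t, ·)` vanishes and `∇q(t, ·) ≡ ∇q(t, 0) =: γ(t)`
  with `‖γ(t)‖ ≤ C₀K/√(−t)³`.

Everything is proved; the only hypothesis is the registered stub statement A1 (an argument of the
theorem, discharged by its own Theorems file).
-/

noncomputable section

open Set Function Filter InnerProductSpace
open scoped Laplacian ContDiff Topology RealInnerProductSpace

namespace Summit.NavierStokesRegularity.NavierStokesRegularity.Theorems

open Literature.Analysis.FluidPDE

/-! ### (P1) The pressure of a tempered Stokes solution is harmonic -/

/-- Inner product with a fixed vector commutes with one-sided time derivatives. -/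
theorem anchor_hasDerivWithinAt_const_inner {F : ℝ → EuclideanSpace ℝ (Fin 3)}
    {F' : EuclideanSpace ℝ (Fin 3)} {s : Set ℝ} {t : ℝ}
    (h : HasDerivWithinAt F F' s t) (c : EuclideanSpace ℝ (Fin 3)) :
    HasDerivWithinAt (fun r => ⟪c, F r⟫) ⟪c, F'⟫ s t := by
  have h2 := (hasDerivWithinAt_const t s c).inner ℝ h
  simpa using h2

/-- **`div ∂ₜv = 0` for a jointly smooth field with divergence-free slices.** With
`S = (−∞, 0)` open, `∂ₜ` and the slice derivative commute
(`IsSmoothSpaceTimeOn.timeDerivWithin_fderiv_slice_apply_of_uniqueDiffOn`), so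
`div ∂ₜv(t, ·)(x) = ∂ₜ (div v(·, x))(t) = 0`. -/
theorem anchor_divergence_timeDeriv_eq_zero
    {v : ℝ → EuclideanSpace ℝ (Fin 3) → EuclideanSpace ℝ (Fin 3)}
    (hv : ContDiffOn ℝ (⊤ : ℕ∞) (uncurry v) (Iio 0 ×ˢ univ))
    (hdiv : ∀ t < 0, VectorCalculus.IsDivFree (v t)) {t : ℝ} (ht : t < 0)
    (x : EuclideanSpace ℝ (Fin 3)) :
    VectorCalculus.divergence (fun y => timeDeriv v t y) x = 0 := by
  have hvS : IsSmoothSpaceTimeOn (Iio 0) v := hv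
  have hU : UniqueDiffOn ℝ (Iio (0 : ℝ)) := isOpen_Iio.uniqueDiffOn
  set b := stdOrthonormalBasis ℝ (EuclideanSpace ℝ (Fin 3)) with hb
  -- `timeDeriv v t = timeDerivWithin (Iio 0) v t` (interior time)
  have hopen : (fun y => timeDeriv v t y) = timeDerivWithin (Iio 0) v t := by
    rw [timeDerivWithin_eq_deriv_of_isOpen_subset isOpen_Iio Subset.rfl ht v]
    rfl
  rw [hopen, divergence_eq_sum_inner_fderiv b]
  -- exchange `D` and `∂ₜ` in each summand
  have hex : ∀ i, fderiv ℝ (timeDerivWithin (Iio 0) v t) x (b i) =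
      timeDerivWithin (Iio 0) (fun s y => fderiv ℝ (v s) y (b i)) t x := fun i =>
    (hvS.timeDerivWithin_fderiv_slice_apply_of_uniqueDiffOn hU ht x (b i)).symm
  simp_rw [hex, timeDerivWithin_apply]
  -- the time lines of the slice derivatives are differentiable within `Iio 0`
  have hD : ∀ i, IsSmoothSpaceTimeOn (Iio 0) (fun s y => fderiv ℝ (v s) y (b i)) := fun i =>
    (hvS.fderiv_slice hU).clm_apply (v := fun _ _ => b i) contDiffOn_const
  have hdiffW : ∀ i, DifferentiableWithinAt ℝ (fun s => fderiv ℝ (v s) x (b i)) (Iio 0) t :=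
    fun i => (hD i).differentiableWithinAt_time ht x
  -- `⟪bᵢ, ∂ₜ(…)⟫ = ∂ₜ⟪bᵢ, …⟫`
  have hin : ∀ i, ⟪b i, derivWithin (fun s => fderiv ℝ (v s) x (b i)) (Iio 0) t⟫ =
      derivWithin (fun s => ⟪b i, fderiv ℝ (v s) x (b i)⟫) (Iio 0) t := by
    intro i
    have h1 := anchor_hasDerivWithinAt_const_inner (hdiffW i).hasDerivWithinAt (b i)
    rw [h1.derivWithin (hU t ht)]
  simp_rw [hin]
  rw [← derivWithin_fun_sum (fun i _ =>
    (anchor_hasDerivWithinAt_const_inner (hdiffW i).hasDerivWithinAt (b i)).differentiableWithinAt)]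
  -- the sum is the divergence, which vanishes on `Iio 0`
  have hsum : ∀ s, (∑ i, ⟪b i, fderiv ℝ (v s) x (b i)⟫) = VectorCalculus.divergence (v s) x :=
    fun s => (divergence_eq_sum_inner_fderiv b (v s) x).symm
  simp_rw [hsum]
  have hcongr : derivWithin (fun s => VectorCalculus.divergence (v s) x) (Iio 0) t =
      derivWithin (fun _ : ℝ => (0 : ℝ)) (Iio 0) t :=
    derivWithin_congr (fun s (hs : s ∈ Iio 0) => hdiv s hs x) (hdiv t ht x)
  rw [hcongr]
  simp

/-- **(P1) The pressure of a tempered classical ancient Stokes solution is harmonic on every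
slice**: `Δq(t, ·) = 0` for `t < 0` (divergence of `∂ₜv = Δv − ∇q` with `div v = 0`). -/
theorem anchor_laplacian_pressure_eq_zero
    {v : ℝ → EuclideanSpace ℝ (Fin 3) → EuclideanSpace ℝ (Fin 3)}
    {q : ℝ → EuclideanSpace ℝ (Fin 3) → ℝ}
    (hv : ContDiffOn ℝ (⊤ : ℕ∞) (uncurry v) (Iio 0 ×ˢ univ))
    (hq : ContDiffOn ℝ (⊤ : ℕ∞) (uncurry q) (Iio 0 ×ˢ univ))
    (hdiv : ∀ t < 0, VectorCalculus.IsDivFree (v t))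
    (heq : ∀ t < 0, ∀ x, timeDeriv v t x = Δ (v t) x - gradient (q t) x) {t : ℝ} (ht : t < 0)
    (x : EuclideanSpace ℝ (Fin 3)) : (Δ (q t)) x = 0 := by
  have hvS : IsSmoothSpaceTimeOn (Iio 0) v := hv
  have hqS : IsSmoothSpaceTimeOn (Iio 0) q := hq
  have hqt : ContDiff ℝ 2 (q t) := (hqS.contDiff_slice ht).of_le (by norm_cast)
  have hvt3 : ContDiff ℝ 3 (v t) := (hvS.contDiff_slice ht).of_le (by norm_cast)
  -- `∇q(t) = Δv(t) − ∂ₜv(t)` as slice functions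
  have hgrad : gradient (q t) = fun y => (Δ (v t)) y - timeDeriv v t y := by
    funext y
    have e := heq t ht y
    rw [e]; abel
  have hΔd : DifferentiableAt ℝ (Δ (v t)) x := by
    have h := (hvS.laplacian isOpen_Iio.uniqueDiffOn).contDiff_slice ht
    exact (h.differentiable (by simp)).differentiableAt
  have hTd : DifferentiableAt ℝ (fun y => timeDeriv v t y) x := by
    have h := (hvS.timeDerivWithin isOpen_Iio.uniqueDiffOn).contDiff_slice ht
    have e : (fun y => timeDeriv v t y) = timeDerivWithin (Iio 0) v t := by
      rw [timeDerivWithin_eq_deriv_of_isOpen_subset isOpen_Iio Subset.rfl ht v]; rfl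
    rw [e]
    exact (h.differentiable (by simp)).differentiableAt
  rw [← divergence_gradient hqt x, hgrad, SteadyCaccioppoli.divergence_sub' hΔd hTd,
    divergence_laplacian_eq_zero hvt3 (hdiv t ht) x,
    anchor_divergence_timeDeriv_eq_zero hv hdiv ht x, sub_zero]

/-! ### (P2) Harmonic pressure of linear growth has constant gradient -/

/-- A directional derivative of a `C^∞` harmonic function is harmonic (`∂ₑΔ = Δ∂ₑ`). -/
theorem anchor_laplacian_fderiv_apply_eq_zero {f : EuclideanSpace ℝ (Fin 3) → ℝ}
    (hf : ContDiff ℝ ∞ f) (hΔ : ∀ x, (Δ f) x = 0) (e x : EuclideanSpace ℝ (Fin 3)) :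
    (Δ fun y => fderiv ℝ f y e) x = 0 := by
  have h3 : ContDiff ℝ 3 f := hf.of_le (by norm_cast)
  rw [← fderiv_laplacian_apply_of_contDiff_three h3 x e]
  have hz : (Δ f) = fun _ => (0 : ℝ) := funext hΔ
  rw [hz, fderiv_fun_const]
  rfl

/-- **(P2) for one slice.** If `f ∈ C^∞(ℝ³)` is harmonic with `|f(x)| ≤ a + b‖x‖` (`a, b ≥ 0`)
and the harmonic gradient estimate A1 holds with constant `C₀`, then `Df` is constant,
`Df(x) = Df(0)`, and `‖Df(0)‖ ≤ C₀ b`. -/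
theorem anchor_fderiv_const_of_harmonic_linearGrowth {C₀ : ℝ}
    (hA1 : ∀ (f : EuclideanSpace ℝ (Fin 3) → ℝ) (a b : ℝ), ContDiff ℝ 2 f →
      (∀ x, Laplacian.laplacian f x = 0) → 0 ≤ a → 0 ≤ b → (∀ x, |f x| ≤ a + b * ‖x‖) →
      ∀ x, ‖fderiv ℝ f x‖ ≤ C₀ * b)
    {f : EuclideanSpace ℝ (Fin 3) → ℝ} (hf : ContDiff ℝ ∞ f) (hΔ : ∀ x, (Δ f) x = 0) {a b : ℝ}
    (ha : 0 ≤ a)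
    (hb : 0 ≤ b) (hgr : ∀ x, |f x| ≤ a + b * ‖x‖) :
    (∀ x, fderiv ℝ f x = fderiv ℝ f 0) ∧ ‖fderiv ℝ f 0‖ ≤ C₀ * b := by
  have h2 : ContDiff ℝ 2 f := hf.of_le (by norm_cast)
  have hgrad : ∀ x, ‖fderiv ℝ f x‖ ≤ C₀ * b := hA1 f a b h2 hΔ ha hb hgr
  have hC₀b : 0 ≤ C₀ * b := (norm_nonneg _).trans (hgrad 0)
  refine ⟨fun x => ?_, hgrad 0⟩
  -- each directional derivative `g = ∂ₑf` is bounded and harmonic, hence has zero gradient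
  ext e
  set g : EuclideanSpace ℝ (Fin 3) → ℝ := fun y => fderiv ℝ f y e with hg
  have hgs : ContDiff ℝ ∞ g := (hf.fderiv_right (m := ∞) (by norm_cast)).clm_apply contDiff_const
  have hg2 : ContDiff ℝ 2 g := hgs.of_le (by norm_cast)
  have hgΔ : ∀ y, (Δ g) y = 0 := fun y => anchor_laplacian_fderiv_apply_eq_zero hf hΔ e y
  have hgb : ∀ y, |g y| ≤ C₀ * b * ‖e‖ + 0 * ‖y‖ := by
    intro y
    rw [zero_mul, add_zero, hg, ← Real.norm_eq_abs]
    exact (ContinuousLinearMap.le_opNorm _ _).trans (mul_le_mul_of_nonneg_right (hgrad y)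
      (norm_nonneg _))
  have hDg : ∀ y, fderiv ℝ g y = 0 := by
    intro y
    have h := hA1 g (C₀ * b * ‖e‖) 0 hg2 hgΔ (by positivity) le_rfl hgb y
    rw [mul_zero] at h
    exact norm_le_zero_iff.1 h
  exact is_const_of_fderiv_eq_zero (hgs.differentiable (by simp)) hDg x 0

/-- **Registered stub A3a (`stub_anchorPressure`) of crux stmt-NavierStokesRegularity-4054, line
`galilean-collapse`: the pressure step of the anchor.** For a tempered classical ancient Stokes
solution `(v, q)` on `(−∞, 0) × ℝ³` — jointly smooth, `‖v‖ ≤ K/√(−t) + K(1+‖x‖)/(−t)`,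
`|q| ≤ K/(−t) + K(1+‖x‖)/√(−t)³`, `div v = 0`, `∂ₜv = Δv − ∇q` — and given the harmonic gradient
estimate (registered stub A1, taken as the first hypothesis), the pressure gradient is constant on
every slice with the scale-natural decay: `∇q(t, x) = ∇q(t, 0)` and `‖∇q(t, 0)‖ ≤ C/√(−t)³`
(`C = C₀K`). Proof: (P1) `Δq(t,·) = 0`; (P2) A1 twice
(`anchor_fderiv_const_of_harmonic_linearGrowth`). -/
theorem stub_anchorPressure :
    (∃ C₀ : ℝ, 0 ≤ C₀ ∧ ∀ (f : EuclideanSpace ℝ (Fin 3) → ℝ) (a b : ℝ), ContDiff ℝ 2 f → (∀ x,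
    Laplacian.laplacian f x = 0) → 0 ≤ a → 0 ≤ b → (∀ x, |f x| ≤ a + b * ‖x‖) → ∀ x, ‖fderiv ℝ
    f x‖ ≤ C₀ * b) → ∀ (v : ℝ → EuclideanSpace ℝ (Fin 3) → EuclideanSpace ℝ (Fin 3)) (q : ℝ →
    EuclideanSpace ℝ (Fin 3) → ℝ), ContDiffOn ℝ (⊤ : ℕ∞) (Function.uncurry v) (Set.Iio 0 ×ˢ
    Set.univ) → ContDiffOn ℝ (⊤ : ℕ∞) (Function.uncurry q) (Set.Iio 0 ×ˢ Set.univ) → (∃ K : ℝ, ∀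
    t < 0, ∀ x, ‖v t x‖ ≤ K / Real.sqrt (-t) + K * (1 + ‖x‖) / (-t) ∧ |q t x| ≤ K / (-t) + K *
    (1 + ‖x‖) / Real.sqrt (-t) ^ 3) → (∀ t < 0,
    Literature.Analysis.FluidPDE.VectorCalculus.IsDivFree (v t)) → (∀ t < 0, ∀ x,
    Literature.Analysis.FluidPDE.timeDeriv v t x = Laplacian.laplacian (v t) x - gradient (q t) x)
    → ∃ C : ℝ, ∀ t < 0, (∀ x, gradient (q t) x = gradient (q t) 0) ∧ ‖gradient (q t) 0‖ ≤ C /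
    Real.sqrt (-t) ^ 3 := by
  rintro ⟨C₀, -, hA1⟩ v q hv hq ⟨K, hK⟩ hdiv heq
  have hqS : IsSmoothSpaceTimeOn (Iio 0) q := hq
  -- `K ≥ 0` (evaluate the velocity bound at `t = -1`, `x = 0`)
  have hK0 : 0 ≤ K := by
    have h1 := (hK (-1) (by norm_num) 0).1
    have h0 : (0 : ℝ) ≤ ‖v (-1) 0‖ := norm_nonneg _
    simp only [neg_neg, Real.sqrt_one, div_one, norm_zero, add_zero, mul_one] at h1
    linarith
  refine ⟨C₀ * K, fun t ht => ?_⟩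
  have hst : 0 < Real.sqrt (-t) := Real.sqrt_pos.2 (by linarith)
  have hnt : 0 < -t := by linarith
  -- the slice `q t` is smooth, harmonic, of linear growth with slope `K/√(−t)³`
  have hqt : ContDiff ℝ ∞ (q t) := hqS.contDiff_slice ht
  have hΔ : ∀ x, (Δ (q t)) x = 0 := fun x => anchor_laplacian_pressure_eq_zero hv hq hdiv heq ht x
  have hgr : ∀ x, |q t x| ≤ (K / (-t) + K / Real.sqrt (-t) ^ 3) + K / Real.sqrt (-t) ^ 3 * ‖x‖ := by
    intro x
    have h := (hK t ht x).2
    have e : K / (-t) + K * (1 + ‖x‖) / Real.sqrt (-t) ^ 3 =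
        (K / (-t) + K / Real.sqrt (-t) ^ 3) + K / Real.sqrt (-t) ^ 3 * ‖x‖ := by ring
    linarith
  obtain ⟨hconst, hbound⟩ := anchor_fderiv_const_of_harmonic_linearGrowth hA1 hqt hΔ
    (by positivity) (by positivity) hgr
  refine ⟨fun x => ?_, ?_⟩
  · simp only [gradient, hconst x]
  · rw [gradient, LinearIsometryEquiv.norm_map]
    calc ‖fderiv ℝ (q t) 0‖ ≤ C₀ * (K / Real.sqrt (-t) ^ 3) := hbound
      _ = C₀ * K / Real.sqrt (-t) ^ 3 := by ring

end Summit.NavierStokesRegularity.NavierStokesRegularity.Theorems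

end
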